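import Literature.MathematicalPhysics.QuantumFieldTheory.Balaban1983to89.B13Lemma1Assembly
import Literature.MathematicalPhysics.QuantumFieldTheory.Balaban1983to89.B13Lemma3Torus

/-!
# `Balaban1983to89.B13Lemma1Torus` — T. Bałaban, *Renormalization group approach to lattice gauge field theories.
II. Cluster expansions*, Commun. Math. Phys. **116** (1988) 1–22, doi:10.1007/bf01239022 [Balaban1988RG2Cluster]:
**Lemma 1 (1.33)–(1.36) p. 9 ON THE PAPERS' PERIODIC CARRIER** — the assembly `B13Lemma1Assembly.lemma1Printed_of_sect1`
(p403319) instantiated at the two-scale TORUS step data `B13Lemma3Torus.TwoTorusStep 4 L N′` (𝐃_k := `tsys 4 (L·N′)`,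
d_k := `torusTreeLen`; [Balaban1987RG1] p. 251: *"a torus T obtained by the usual identification of boundary points of
the cube"*) with the two GEOMETRIC inputs of the pp. 7–8 resummation DISCHARGED as theorems of the torus: the input of
(1.25) d_k(Y) ≤ d_k(□₀) + 4M⁻⁴|Y₀∖□̃⁴| (the adjoining inequality
`TreeLengthTorusTransfer.torusTreeLen_le_card_sdiff_add`) and the outer inequality of (1.28)
#{□₀ ⊂ Y} ≤ exp((1/16)(κ₁ − 2)d_k(Y)) (the repaired volume law `TreeLengthTorus.card_le_torusTreeLen` + the floor
d_k(Y) ≥ 1 for the Y that contain a □₀ + `B13Sect1Arith.bound_128_repaired`)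

statement-level skeleton of published theorems with citation tags; proofs where landed; nothing here is a claim about
the Yang–Mills mass gap

PDF held: `paper:balaban1988-cmp116-rg-ii-cluster` (journal page = PDF page + 0); pp. 7–9 re-read this session as images
(`…/1988-cmp116-rg-II-cluster-p008-x2.png`, `…-p009-x2.png`) and from the text layer; the displays are quoted
verbatim in `B13Lemma1Assembly` / `B13Sect1Arith`.

CITATION HEADER / WHAT IS REPRODUCED (cell `pub-ymgap`, Track A node N10 = [B13], prover seat `pub-ymgap-dag-p2`, third
module; `HOME/pub-ymgap-plan/FIRST3-READINESS.md` §2 N10: *«FIRST MISSING LEMMA: Lemma 1 (p. 9) on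
`TwoTorusStep 4 L N'`»*; a NEW LEAF importing `B13Lemma1Assembly` and `B13Lemma3Torus`, nothing there modified).
p. 7 [PDF 7], verbatim: *"Adding and subtracting ⅛κ₁d_k(□₀) under the first exponential above, we can bound it by
exp(−⅛(κ₁ − 1)d_k(Y) + ⅛κ₁d_k(□₀) − ½(κ₁ − 1)M⁻⁴|Y₀∖□̃⁴|), (1.25) where Y = Y₀ ∪ □₀. Of course Y is a localization
domain form 𝐃_k."*;
p. 8 [PDF 8]: *"Finally, the sum over □₀ can be bounded by M⁻⁴|Y| ≤ 3·2³d_k(Y) ≤ exp(1/16)(κ₁ − 2)d_k(Y). (1.28)"*.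
* §1 TORUS GEOMETRY (every d, N): `one_le_torusTreeLen_of_card` — a torus localization domain with ≥ 5·2^d cubes has
  d_j ≥ 1 (from |X̄| ≤ 2^d(4d_j(X̄) + 1)); `outer128_torus` — **the outer inequality of (1.28) PROVED on the torus**: if
  the admissible □₀ ⊂ Y are at most M⁻⁴|Y| in number (p. 8) and Y has ≥ 5·2^d cubes whenever one □₀ ⊂ Y exists, then
  #{□₀} ≤ exp((1/16)(κ₁ − 2)d_k(Y)) for κ₁ ≥ 2 + 16 log(8·2^d) (d = 4: κ₁ ≥ 2 + 16 log 128; the printed inner step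
  M⁻⁴|Y| ≤ 3·2³d_k(Y) is false for degenerate Y — cell GAPS G-B13-07 — and is NOT used: the repaired law
  |Y| ≤ 2^d(4d_k(Y) + 1) with the floor replaces it); `g1_torus` — **the geometric input of (1.25) PROVED on the
  torus**: □₀ ⊆ Y both torus localization domains ⇒ d_k(Y) ≤ d_k(□₀) + #(Y∖□₀) ≤ d₀ + 4N for every N ≥ #(Y∖□₀)
  ([Dimock2013] Lemma 20 on the torus, coefficient 1 ≤ the printed 4); `card_le_mul_exp_torus` — the □-count of
  p. 9 in its REPAIRED form #(cubes of Y) ≤ 4·2^d·e^{t d_k(Y)} (t ≥ 1), for the (I.3.7)-type chain on the torus.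
* §2 `lemma1Printed_twoTorus` — `B13.Lemma1Printed W.toStepData c` for two-torus step data `W : TwoTorusStep 4 L N′`
  from the located inputs of `B13Lemma1Assembly.lemma1Printed_of_sect1` with `hG1` and `h128` REPLACED by torus data:
  each admissible □₀ (`a ∈ S0 Y`) carries its family of M-cubes `blk Y a ⊆ Y` (a torus localization domain with
  d_k ≤ d₀ and ≥ 5·2⁴ = 80 cubes — □₀ ⊋ □̃⁴ is a block of side ≥ 3), N = M⁻⁴|Y₀∖□̃⁴| ≥ #(Y∖□₀) (Y∖□₀ ⊆ Y₀∖□̃⁴, p. 7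
  *"Y = Y₀ ∪ □₀"*), #{□₀ ⊂ Y} ≤ M⁻⁴|Y| = #(cubes of Y) (p. 8).  What stays a hypothesis is what stays one in
  `B13Lemma1Assembly` minus G1 and (1.28): the per-term bound (1.24) and analyticity, «8·12³» (the cubes of □₀∖□̃⁴ —
  [I]'s block geometry, NODE 00's objects), (1.26) at the scales j ≤ k (PROVED per scale on the torus by
  `TreeLengthTorus.ineq126_torus` / `hTree_scales_torus`, κ ≥ κ₀(64, 8), O(1) = K₀(64, 8); carried here over the
  abstract index families of the scales j < k, which two-torus step data do not model), «(6L)⁴L^jη», the (I.3.7)-type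
  bound of p. 9 (its chain = `B13Lemma1Eq130`), R9, the thresholds, the constants.
HONEST FRAMING: a count-neutral Track-A side landing (YM-PLAN §1); NOT a discharge of node N10 (the B13 group `X.S13` is
FREE at NODE 00 Stages 1–2, `Node00.CarriersFrame.carriers₁_groupB13`); one finite T⁴ programme at fixed ε; nothing
continuum / OS / mass-gap / Clay.
-/

noncomputable section

namespace Literature.MathematicalPhysics.QuantumFieldTheory.Balaban1983to89.B13Lemma1Torus

open Literature.MathematicalPhysics.QuantumFieldTheory.Balaban1983to89
open Literature.MathematicalPhysics.QuantumFieldTheory.Balaban1983to89.TreeLengthTorus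
open Literature.MathematicalPhysics.QuantumFieldTheory.Balaban1983to89.TreeLengthTorusTransfer
  (torusTreeLen_le_card_sdiff_add)
open Literature.MathematicalPhysics.QuantumFieldTheory.Balaban1983to89.B13Lemma3Torus (TwoTorusStep)

/-! ## §1. Torus geometry: the floor, the outer inequality of (1.28), the input of (1.25) -/

section Geometry

variable {d N : ℕ} [NeZero N]

/-- THE FLOOR: a torus localization domain with at least 5·2^d cubes has d_j ≥ 1 — from the repaired volume law
|X̄| ≤ 2^d(4d_j(X̄) + 1) (`TreeLengthTorus.card_le_torusTreeLen`; cell GAPS G-B13-07).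
[cite: Balaban1988RG2Cluster, (2.30) p.18 (lower half, repaired form)] -/
theorem one_le_torusTreeLen_of_card {Y : Finset (TPt d N)} (hY : Y.Nonempty) (hc : TFaceConnected Y)
    (hbig : (5 : ℝ) * 2 ^ d ≤ Y.card) : 1 ≤ torusTreeLen Y := by
  have h := card_le_torusTreeLen hY hc
  have h2 : (0 : ℝ) < 2 ^ d := by positivity
  by_contra hlt
  have hlt' : torusTreeLen Y < 1 := not_le.mp hlt
  have : (2 : ℝ) ^ d * (4 * torusTreeLen Y + 1) < 2 ^ d * 5 := by
    exact mul_lt_mul_of_pos_left (by linarith) h2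
  linarith

/-- **The outer inequality of (1.28) p. 8 ON THE TORUS** (*"Finally, the sum over □₀ can be bounded by M⁻⁴|Y| ≤
3·2³d_k(Y) ≤ exp(1/16)(κ₁ − 2)d_k(Y). (1.28)"*): if the number `n` of admissible □₀ ⊂ Y is at most the number of
M-cubes of Y (p. 8) and Y has at least 5·2^d cubes as soon as one □₀ ⊂ Y exists (□₀ ⊋ □̃⁴), then
`n ≤ exp((1/16)(κ₁ − 2)d_k(Y))` for κ₁ ≥ 2 + 16 log(2·4·2^d) — through the floor d_k(Y) ≥ 1 and
`B13Sect1Arith.bound_128_repaired` with A = 4·2^d, d₀ = 1 (the printed middle term 3·2³d_k(Y) is bypassed: it is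
false for degenerate Y, cell GAPS G-B13-07). [cite: Balaban1988RG2Cluster, (1.28) p.8] -/
theorem outer128_torus {Y : Finset (TPt d N)} (hY : Y.Nonempty) (hc : TFaceConnected Y) {n : ℕ} (hn : n ≤ Y.card)
    (hbig : 0 < n → (5 : ℝ) * 2 ^ d ≤ Y.card) {κ₁ : ℝ} (hκ₁ : 2 + 16 * Real.log (2 * (4 * 2 ^ d)) ≤ κ₁) :
    (n : ℝ) ≤ Real.exp ((1 / 16) * (κ₁ - 2) * torusTreeLen Y) := by
  rcases Nat.eq_zero_or_pos n with h0 | hpos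
  · subst h0
    simpa using (Real.exp_pos _).le
  · have hd : 1 ≤ torusTreeLen Y := one_le_torusTreeLen_of_card hY hc (hbig hpos)
    have hvol := card_le_torusTreeLen hY hc
    have hA : (0 : ℝ) < 4 * 2 ^ d := by positivity
    have h1 : (1 : ℝ) ≤ 2 ^ d := one_le_pow₀ (by norm_num)
    refine B13Sect1Arith.bound_128_repaired (A := 4 * 2 ^ d) (d₀ := 1) hA one_pos ?_ ?_ hd ?_
    · have : Real.exp 1 < 2.7182818286 := Real.exp_one_lt_d9
      nlinarith
    · have : (n : ℝ) ≤ Y.card := by exact_mod_cast hn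
      nlinarith [torusTreeLen_nonneg Y]
    · have e : (4 : ℝ) * 2 ^ d * (1 + 1) = 2 * (4 * 2 ^ d) := by ring
      rw [e]
      linarith

/-- **The geometric input of (1.25) p. 7 ON THE TORUS** (*"Adding and subtracting ⅛κ₁d_k(□₀) … (1.25) where
Y = Y₀ ∪ □₀"*; cell census G1: d_k(Y) ≤ d_k(□₀) + 4M⁻⁴|Y₀∖□̃⁴|): for torus localization domains □₀ = `B` ⊆ `Y`,
d_k(Y) ≤ #(Y∖B) + d_k(B) (the adjoining inequality `TreeLengthTorusTransfer.torusTreeLen_le_card_sdiff_add`,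
[Dimock2013] Lemma 20), hence d_k(Y) ≤ d₀ + 4N for every d₀ ≥ d_k(B) and N ≥ #(Y∖B) (N = M⁻⁴|Y₀∖□̃⁴| qualifies since
Y∖□₀ ⊆ Y₀∖□̃⁴). [cite: Balaban1988RG2Cluster, (1.25) p.7] -/
theorem g1_torus {B Y : Finset (TPt d N)} (hB : IsTDom B) (hYc : TFaceConnected Y) (hBY : B ⊆ Y) {d0 n : ℝ}
    (hd0 : torusTreeLen B ≤ d0) (hn : ((Y \ B).card : ℝ) ≤ n) : torusTreeLen Y ≤ d0 + 4 * n := by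
  have h := torusTreeLen_le_card_sdiff_add hB.1 hBY hB.2 hYc
  have hn0 : (0 : ℝ) ≤ ((Y \ B).card : ℝ) := Nat.cast_nonneg _
  linarith

/-- **The □-count of p. 9 in its REPAIRED form ON THE TORUS** (p. 9: *"Finally, the sum over all possible cubes □ can
be bounded by M⁻⁴|Y| ≤ 3·2³d_k(Y) ≤ exp δκd_k(Y)"* — the middle term fails for degenerate Y, cell GAPS G-B13-07; the
repair keeps an absolute factor): for every torus localization domain Y and every rate t ≥ 1,
#(cubes of Y) ≤ 4·2^d·exp(t·d_j(Y)) (d = 4: 64·e^{t d_j(Y)}), from |Y| ≤ 2^d(4d_j(Y) + 1) and 1 + x ≤ eˣ.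
[cite: Balaban1988RG2Cluster, p.9 (the sum over the cubes □, repaired form)] -/
theorem card_le_mul_exp_torus {Y : Finset (TPt d N)} (hY : Y.Nonempty) (hc : TFaceConnected Y) {t : ℝ}
    (ht : 1 ≤ t) : (Y.card : ℝ) ≤ 4 * 2 ^ d * Real.exp (t * torusTreeLen Y) := by
  have h := card_le_torusTreeLen hY hc
  have hd := torusTreeLen_nonneg Y
  have h2 : (0 : ℝ) < 2 ^ d := by positivity
  have hexp : 1 + t * torusTreeLen Y ≤ Real.exp (t * torusTreeLen Y) := by
    have := Real.add_one_le_exp (t * torusTreeLen Y); linarith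
  have h3 : 4 * torusTreeLen Y + 1 ≤ 4 * (1 + t * torusTreeLen Y) := by nlinarith
  calc (Y.card : ℝ) ≤ 2 ^ d * (4 * torusTreeLen Y + 1) := h
    _ ≤ 2 ^ d * (4 * (1 + t * torusTreeLen Y)) := mul_le_mul_of_nonneg_left h3 h2.le
    _ ≤ 2 ^ d * (4 * Real.exp (t * torusTreeLen Y)) :=
        mul_le_mul_of_nonneg_left (mul_le_mul_of_nonneg_left hexp (by norm_num)) h2.le
    _ = 4 * 2 ^ d * Real.exp (t * torusTreeLen Y) := by ring

end Geometry

/-! ## §2. Lemma 1 on the two-scale torus model -/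

section Torus

variable {L N' : ℕ} [NeZero L] [NeZero N']

/-- **LEMMA 1 (1.33)–(1.36) p. 9 ON THE TWO-SCALE TORUS MODEL** `W : TwoTorusStep 4 L N′` (𝐃_k = the torus
`tsys 4 (L·N′)` of M-cubes, d_k = `torusTreeLen`): `B13.Lemma1Printed W.toStepData c` from the located inputs of
`B13Lemma1Assembly.lemma1Printed_of_sect1` — (a) V′_k(Y) = the Y-sum of the terms (1.23) + the (I.3.7)-type Y-sum
(`h133`); (b) per-term analyticity p. 7 / p. 9 and the closure of `W.Analytic` under finite sums ([folklore]); (c) the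
per-term bound (1.24) on (1.34) (`h124`, by reference to (I.3.54), [15] Prop. 4, [13] (3.108)); (e) «8·12³» (`hF`),
(1.26) at the scales j ≤ k (`h126`; per scale a THEOREM of the torus, `TreeLengthTorus.ineq126_torus`), «(6L)⁴L^jη»
(`hq`); (f) κ₁ ≥ 1 + 2 log(8·12³), L ≥ 2; (g) the p. 9 bound for the (I.3.7)-type sum (`h129'`; its chain is
`B13Lemma1Eq130.boundP9_of_130`); (h) R9; (i) the constants (`hC`) — WITH THE GEOMETRY OF (1.25) AND (1.28) PROVED:
the admissible □₀ (`a ∈ S0 Y`) come with their families of M-cubes `blk Y a` ⊆ Y, torus localization domains with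
d_k(blk) ≤ d₀ and ≥ 80 = 5·2⁴ cubes (`hblk`; □₀ ⊋ □̃⁴ is a block of side ≥ 3 — [I] Sect. 3), N = M⁻⁴|Y₀∖□̃⁴| ≥
#(Y∖□₀) (`hNblk`; Y = Y₀ ∪ □₀, p. 7) and #{□₀ ⊂ Y} ≤ M⁻⁴|Y| (`hS0`; p. 8); then `g1_torus` gives the input of (1.25)
and `outer128_torus` the outer inequality of (1.28), for κ₁ ≥ 2 + 16 log 128 (`hκ₁'`).
[cite: Balaban1988RG2Cluster, Lemma 1 pp.7–9] -/
theorem lemma1Printed_twoTorus (W : TwoTorusStep 4 L N') (c : B13.Consts) {α γ δ C : Type*}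
    (S0 : TDom 4 (L * N') → Finset α) (blk : TDom 4 (L * N') → α → Finset (TPt 4 (L * N')))
    (F : TDom 4 (L * N') → α → Finset C) (k : ℕ) (Sq : TDom 4 (L * N') → ℕ → Finset γ)
    (SX : TDom 4 (L * N') → ℕ → γ → Finset δ) (T : TDom 4 (L * N') → α → Finset C → ℕ → γ → δ → W.Φ → ℂ)
    (dj : TDom 4 (L * N') → ℕ → γ → δ → ℝ) (N : TDom 4 (L * N') → α → Finset C → ℝ)
    (W₂ : TDom 4 (L * N') → W.Φ → ℂ) {K O1 d0 P₂ : ℝ}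
    (h133 : ∀ Y, W.Vp Y = (∑ a ∈ S0 Y, ∑ X ∈ (F Y a).powerset, ∑ j ∈ Finset.range (k + 1), ∑ q ∈ Sq Y j,
      ∑ x ∈ SX Y j q, T Y a X j q x) + W₂ Y)
    (hAdd : ∀ (s : Set W.Φ) (f g : W.Φ → ℂ), W.Analytic f s → W.Analytic g s → W.Analytic (f + g) s)
    (hZero : ∀ s : Set W.Φ, W.Analytic 0 s)
    (hAnT : ∀ Y, ∀ a ∈ S0 Y, ∀ X ∈ (F Y a).powerset, ∀ j ∈ Finset.range (k + 1), ∀ q ∈ Sq Y j, ∀ x ∈ SX Y j q,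
      W.Analytic (T Y a X j q x) (W.sp1 Y))
    (hAn₂ : ∀ Y, W.Analytic (W₂ Y) (W.sp1 Y))
    (hK : 0 ≤ K) (hO1 : 0 ≤ O1) (hd0 : 0 ≤ d0) (hL : 2 ≤ (c.L : ℝ))
    (hκ₁ : 1 + 2 * Real.log (8 * 12 ^ 3) ≤ c.κ₁) (hκ₁' : 2 + 16 * Real.log 128 ≤ c.κ₁)
    (h124 : ∀ Y φ, φ ∈ W.sp1 Y → ∀ a ∈ S0 Y, ∀ X ∈ (F Y a).powerset, ∀ j ∈ Finset.range (k + 1), ∀ q ∈ Sq Y j,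
      ∀ x ∈ SX Y j q, ‖T Y a X j q x φ‖ ≤ K * ((c.L : ℝ) ^ j * ((c.L : ℝ) ^ k)⁻¹) ^ 5 *
        Real.exp (-(c.κ₁ - 1) * N Y a X) * Real.exp (-(c.κ * dj Y j q x)))
    (hblk : ∀ Y, ∀ a ∈ S0 Y, blk Y a ⊆ Y.1 ∧ IsTDom (blk Y a) ∧ torusTreeLen (blk Y a) ≤ d0 ∧
      (5 : ℝ) * 2 ^ 4 ≤ (blk Y a).card)
    (hNblk : ∀ Y, ∀ a ∈ S0 Y, ∀ X ∈ (F Y a).powerset, ((Y.1 \ blk Y a).card : ℝ) ≤ N Y a X)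
    (hN : ∀ Y a, ∀ X ∈ (F Y a).powerset, (X.card : ℝ) ≤ N Y a X)
    (hF : ∀ Y a, ((F Y a).card : ℝ) ≤ 8 * 12 ^ 3)
    (hS0 : ∀ Y, (S0 Y).card ≤ Y.1.card)
    (h126 : ∀ Y, ∀ j ∈ Finset.range (k + 1), ∀ q ∈ Sq Y j,
      ∑ x ∈ SX Y j q, Real.exp (-(c.κ * dj Y j q x)) ≤ O1)
    (hq : ∀ Y, ∀ j ∈ Finset.range (k + 1),
      ((Sq Y j).card : ℝ) * ((c.L : ℝ) ^ j * ((c.L : ℝ) ^ k)⁻¹) ^ 5 ≤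
        (6 * (c.L : ℝ)) ^ 4 * ((c.L : ℝ) ^ j * ((c.L : ℝ) ^ k)⁻¹))
    (h129' : ∀ Y φ, φ ∈ W.sp1 Y → ‖W₂ Y φ‖ ≤ P₂ * Real.exp (-(1 - 2 * c.δ) * c.κ * torusTreeLen Y.1))
    (hR9 : (1 - 2 * c.δ) * c.κ ≤ (1 / 16) * c.κ₁)
    (hC : K * O1 * (2 * (6 * (c.L : ℝ)) ^ 4) * Real.exp 1 * Real.exp ((1 / 8) * c.κ₁ * d0) + P₂ ≤
      c.E₀ * c.ε₁ * c.C₁ * c.M ^ c.q * Real.exp (c.C₂ * c.κ₁)) :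
    B13.Lemma1Printed W.toStepData c := by
  -- the two geometric inputs, discharged on the torus
  have hG1 : ∀ Y : TDom 4 (L * N'), ∀ a ∈ S0 Y, ∀ X ∈ (F Y a).powerset,
      W.toStepData.Dk.dj Y ≤ d0 + 4 * N Y a X := by
    intro Y a ha X hX
    obtain ⟨hsub, hdom, hlen, -⟩ := hblk Y a ha
    exact g1_torus hdom Y.2.2 hsub hlen (hNblk Y a ha X hX)
  have h128 : ∀ Y : TDom 4 (L * N'),
      ((S0 Y).card : ℝ) ≤ Real.exp ((1 / 16) * (c.κ₁ - 2) * W.toStepData.Dk.dj Y) := by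
    intro Y
    refine outer128_torus (d := 4) Y.2.1 Y.2.2 (hS0 Y) (fun hpos => ?_) (by norm_num; exact hκ₁')
    obtain ⟨a, ha⟩ := Finset.card_pos.mp hpos
    obtain ⟨hsub, -, -, hbig⟩ := hblk Y a ha
    exact hbig.trans (by exact_mod_cast Finset.card_le_card hsub)
  exact B13Lemma1Assembly.lemma1Printed_of_sect1 W.toStepData c S0 F k Sq SX T dj N W₂ h133 hAdd hZero hAnT hAn₂
    hK hO1 hd0 hL hκ₁ h124 hG1 hN hF h126 hq h128 h129' hR9 hC

end Torus

end Literature.MathematicalPhysics.QuantumFieldTheory.Balaban1983to89.B13Lemma1Torus
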